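import Literature.ModelTheory.ExponentialFields.DefinablyCompleteMeanValue
import Literature.ModelTheory.ExponentialFields.DefinablyCompactBoxes
import Mathlib.Data.Finset.Max
import HarnessLib

/-!
# The inverse function theorem over a definably complete ordered field, I: Jacobian near the identity

Topic `Literature/ModelTheory/ExponentialFields`.  Part of the first-order calculus of
definable maps over a definably complete ordered field `K` (the models of `OEF ∪ [DC]`),
following Fornasiero–Servi, *Definably complete Baire structures*, Fund. Math. 209 (2010),
§1.2 ("most results of elementary real analysis can be proved in every definably complete
expansion of an ordered field"; the inverse and implicit function theorems for `C¹` maps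
`Kⁿ → Kⁿ` are used throughout their §§1.2, 8).  There is no norm and no Cauchy completeness,
so the classical contraction argument is replaced by the mean value formula of
`DefinablyCompleteMeanValue.lean` and the extreme value theorem on closed boxes of
`DefinablyCompactBoxes.lean` (the minimisation proof of the inverse function theorem, as in
van den Dries, *Tame topology*, Ch. 7, §2).  This file treats a definable map `F : Kⁿ → Kⁿ`
whose Jacobian `J = (∂Fᵢ/∂xⱼ)` is *close to the identity* on a box,
`|J x i j - δᵢⱼ| ≤ η` with `2 n η ≤ 1` (the general case reduces to this one by a linear change
of coordinates):

* `eq_zero_of_forall_sum_mul_eq_zero` — *diagonal dominance*: such a matrix has trivial left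
  kernel, `(∀ j, Σᵢ vᵢ Jᵢⱼ = 0) → v = 0` (pure algebra in an ordered field);
* **`IsDefinablyComplete.abs_sub_le_two_mul_of_jacobian_near_one`** — the *expansion bound*:
  on a box where the Jacobian is within `η` of the identity,
  `|yᵢ - xᵢ| ≤ 2 · maxₖ |F y k - F x k|`; in particular `F` is injective there
  (`IsDefinablyComplete.injOn_of_jacobian_near_one`);
* **`IsDefinablyComplete.exists_eq_of_jacobian_near_one`** — the *open mapping part*: if `F`
  is continuous on the closed box of radius `r` around `a` with Jacobian within `η` of the
  identity there, then every `y` with `Σᵢ |yᵢ - F a i| < r / 4` is a value `F x` with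
  `|xᵢ - aᵢ| < r` (minimise `Σₖ (F x k - yₖ)²` over the box: the minimum is interior by the
  expansion bound, the partial derivatives `2 Σₖ (F x k - yₖ) Jₖⱼ` vanish there, and diagonal
  dominance gives `F x = y`).

Everything is proved; no definitions, no named facts.  Conventions (`hDC`, `hlt`, `hadd`,
`hmul`, `DefinableFun`) as in the other definable-calculus files; a map `F : Kⁿ → Kⁿ` is
handled through its components `x ↦ F x i`.

## References

* A. Fornasiero, T. Servi, *Definably complete Baire structures*, Fund. Math. 209 (2010),
  §1.2. [FornasieroServi2010]
* L. van den Dries, *Tame topology and o-minimal structures* (1998), Ch. 7, §2.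
  [Dries1998]
* C. Miller, *Expansions of dense linear orders with the intermediate value property*,
  J. Symbolic Logic 66 (2001) 1783–1790. [Miller2001]
-/

open Set Function FirstOrder FirstOrder.Language
open _root_.Filter _root_.Topology

namespace Literature.ModelTheory.ExponentialFields

universe u v

variable {K : Type*} [Field K] [LinearOrder K] [IsStrictOrderedRing K] [TopologicalSpace K]
  [OrderTopology K] {L : FirstOrder.Language.{u, v}} [L.Structure K] {n : ℕ}

/-! ### Algebra: finite sums of derivatives and of definable functions, diagonal dominance -/

omit [LinearOrder K] [IsStrictOrderedRing K] [OrderTopology K] [L.Structure K] in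
/-- Finite sums of differentiable functions. [folklore] -/
theorem HasFieldDerivAt.sum [IsTopologicalRing K] {ι : Type*} (s : Finset ι) {f : ι → K → K}
    {f' : ι → K} {x : K} (h : ∀ k ∈ s, HasFieldDerivAt (f k) (f' k) x) :
    HasFieldDerivAt (fun y => ∑ k ∈ s, f k y) (∑ k ∈ s, f' k) x := by
  classical
  induction s using Finset.induction_on with
  | empty => simpa using hasFieldDerivAt_const (0 : K) x
  | insert a s ha ih =>
      have h1 := (h a (Finset.mem_insert_self a s)).add
        (ih fun k hk => h k (Finset.mem_insert_of_mem hk))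
      simpa only [Finset.sum_insert ha] using h1

omit [LinearOrder K] [IsStrictOrderedRing K] [TopologicalSpace K] [OrderTopology K] in
/-- Finite sums of definable functions of tuples are definable (graph of `+` definable).
[folklore] -/
theorem definableFun_sum
    (hadd : (univ : Set K).Definable L {v : Fin 3 → K | v 2 = v 0 + v 1})
    {α ι : Type*} (s : Finset ι) {g : ι → (α → K) → K}
    (hg : ∀ k ∈ s, (univ : Set K).DefinableFun L (g k)) :
    (univ : Set K).DefinableFun L (fun v => ∑ k ∈ s, g k v) := by
  classical
  induction s using Finset.induction_on with
  | empty =>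
      simpa using definableFun_const_params (L := L) (A := (univ : Set K)) α (mem_univ (0 : K))
  | insert a s ha ih =>
      have h1 := definableFun_apply₂_params hadd (hg a (Finset.mem_insert_self a s))
        (ih fun k hk => hg k (Finset.mem_insert_of_mem hk))
      simpa only [Finset.sum_insert ha] using h1

omit [TopologicalSpace K] [OrderTopology K] [L.Structure K] in
/-- **Diagonal dominance**: if `|A i j - δᵢⱼ| ≤ η` for all `i, j` with `2 n η ≤ 1`, then the
only `v` with `Σᵢ vᵢ Aᵢⱼ = 0` for all `j` is `v = 0` (look at a largest `|vᵢ|`). [folklore] -/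
theorem eq_zero_of_forall_sum_mul_eq_zero {A : Fin n → Fin n → K} {η : K}
    (hη : 2 * n * η ≤ 1) (hA : ∀ i j, |A i j - if i = j then 1 else 0| ≤ η)
    {v : Fin n → K} (hv : ∀ j, ∑ i, v i * A i j = 0) : v = 0 := by
  classical
  rcases isEmpty_or_nonempty (Fin n) with hn | hn
  · exact funext fun i => (hn.false i).elim
  obtain ⟨i₀, -, hi₀⟩ :=
    Finset.exists_max_image Finset.univ (fun i => |v i|) Finset.univ_nonempty
  set m : K := |v i₀| with hm
  have hm0 : 0 ≤ m := abs_nonneg _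
  have hη0 : 0 ≤ η := (abs_nonneg _).trans (hA i₀ i₀)
  have hle : ∀ i, |v i| ≤ m := fun i => hi₀ i (Finset.mem_univ i)
  -- `v i₀ = Σᵢ vᵢ (δ_{i i₀} - A i i₀)`
  have hδ : ∑ i, v i * (if i = i₀ then (1 : K) else 0) = v i₀ := by
    simp [mul_ite]
  have hkey : v i₀ = ∑ i, v i * ((if i = i₀ then (1 : K) else 0) - A i i₀) := by
    simp only [mul_sub, Finset.sum_sub_distrib, hδ, hv, sub_zero]
  have hbound : m ≤ n * (m * η) := by
    calc m = |∑ i, v i * ((if i = i₀ then (1 : K) else 0) - A i i₀)| := by rw [hm, ← hkey]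
      _ ≤ ∑ i, |v i * ((if i = i₀ then (1 : K) else 0) - A i i₀)| :=
          Finset.abs_sum_le_sum_abs _ _
      _ ≤ ∑ _i : Fin n, m * η := by
          refine Finset.sum_le_sum fun i _ => ?_
          rw [abs_mul]
          refine mul_le_mul (hle i) ?_ (abs_nonneg _) hm0
          rw [abs_sub_comm]
          exact hA i i₀
      _ = n * (m * η) := by simp
  have hm2 : m ≤ m / 2 := by
    have h1 : n * (m * η) = (n * η) * m := by ring
    have h2 : (n : K) * η ≤ 1 / 2 := by
      have : (0 : K) < 2 := two_pos
      rw [le_div_iff₀ this]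
      linarith
    calc m ≤ (n * η) * m := by rw [← h1]; exact hbound
      _ ≤ 1 / 2 * m := mul_le_mul_of_nonneg_right h2 hm0
      _ = m / 2 := by ring
  have hmz : m = 0 := le_antisymm (by linarith) hm0
  funext i
  have := hle i
  rw [hmz] at this
  exact abs_nonpos_iff.1 this

/-! ### The expansion bound and injectivity -/

/-- **The expansion bound**: let the definable map `F` (components `x ↦ F x i`) have partial
derivatives `J w i j = ∂Fᵢ/∂xⱼ (w)` at every point `w` of the closed box spanned by `x` and
`y`, with `|J w i j - δᵢⱼ| ≤ η`, `2 n η ≤ 1`.  If `|F y k - F x k| ≤ μ` for all `k`, then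
`|yᵢ - xᵢ| ≤ 2 μ` for all `i`.  (Mean value formula for the component `i₀` maximising
`|yᵢ - xᵢ|`: `yᵢ₀ - xᵢ₀ = (F y i₀ - F x i₀) - Σⱼ (J(ξⱼ) i₀ j - δ) (yⱼ - xⱼ)`.) [folklore] -/
theorem _root_.FirstOrder.Language.IsDefinablyComplete.abs_sub_le_two_mul_of_jacobian_near_one
    (hDC : L.IsDefinablyComplete K)
    (hlt : (univ : Set K).Definable L {v : Fin 2 → K | v 0 < v 1})
    (hadd : (univ : Set K).Definable L {v : Fin 3 → K | v 2 = v 0 + v 1})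
    (hmul : (univ : Set K).Definable L {v : Fin 3 → K | v 2 = v 0 * v 1})
    {F : (Fin n → K) → Fin n → K} (hF : ∀ i, (univ : Set K).DefinableFun L fun x => F x i)
    {J : (Fin n → K) → Fin n → Fin n → K} {η : K} (hη : 2 * n * η ≤ 1) {x y : Fin n → K}
    (hder : ∀ w : Fin n → K, (∀ j, min (x j) (y j) ≤ w j ∧ w j ≤ max (x j) (y j)) →
      ∀ i j, HasPartialDerivAt (fun z => F z i) j (J w i j) w)
    (hJ : ∀ w : Fin n → K, (∀ j, min (x j) (y j) ≤ w j ∧ w j ≤ max (x j) (y j)) →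
      ∀ i j, |J w i j - if i = j then 1 else 0| ≤ η)
    {μ : K} (hμ : ∀ k, |F y k - F x k| ≤ μ) : ∀ i, |y i - x i| ≤ 2 * μ := by
  classical
  rcases isEmpty_or_nonempty (Fin n) with hn | hn
  · exact fun i => (hn.false i).elim
  obtain ⟨i₀, -, hi₀⟩ :=
    Finset.exists_max_image Finset.univ (fun i => |y i - x i|) Finset.univ_nonempty
  set m : K := |y i₀ - x i₀| with hm
  have hm0 : 0 ≤ m := abs_nonneg _
  have hle : ∀ i, |y i - x i| ≤ m := fun i => hi₀ i (Finset.mem_univ i)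
  have hη0 : 0 ≤ η :=
    (abs_nonneg _).trans (hJ x (fun j => ⟨min_le_left _ _, le_max_left _ _⟩) i₀ i₀)
  -- mean value formula for the component `i₀`
  obtain ⟨ξ, hξ, heq⟩ := hDC.exists_sub_eq_sum_partial_mul hlt hadd hmul (hF i₀)
    (p := fun j w => J w i₀ j) x y (fun w hw j => hder w hw i₀ j)
  -- `y i₀ - x i₀ = (F y i₀ - F x i₀) - Σⱼ (J (ξ j) i₀ j - δ) (y j - x j)`
  have hδ : ∑ j, (if i₀ = j then (1 : K) else 0) * (y j - x j) = y i₀ - x i₀ := by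
    simp [ite_mul]
  have hkey : y i₀ - x i₀ = (F y i₀ - F x i₀) -
      ∑ j, (J (ξ j) i₀ j - if i₀ = j then (1 : K) else 0) * (y j - x j) := by
    simp only [sub_mul, Finset.sum_sub_distrib, hδ, heq]
    ring
  have hbound : m ≤ μ + n * (η * m) := by
    calc m = |(F y i₀ - F x i₀) -
          ∑ j, (J (ξ j) i₀ j - if i₀ = j then (1 : K) else 0) * (y j - x j)| := by
            rw [hm, ← hkey]
      _ ≤ |F y i₀ - F x i₀| +
          |∑ j, (J (ξ j) i₀ j - if i₀ = j then (1 : K) else 0) * (y j - x j)| := abs_sub _ _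
      _ ≤ μ + ∑ _j : Fin n, η * m := by
          refine add_le_add (hμ i₀) ((Finset.abs_sum_le_sum_abs _ _).trans
            (Finset.sum_le_sum fun j _ => ?_))
          rw [abs_mul]
          exact mul_le_mul (hJ (ξ j) (hξ j) i₀ j) (hle j) (abs_nonneg _) hη0
      _ = μ + n * (η * m) := by simp
  have hm2 : m ≤ 2 * μ := by
    have h1 : n * (η * m) = (n * η) * m := by ring
    have h2 : (n : K) * η * m ≤ 1 / 2 * m := by
      refine mul_le_mul_of_nonneg_right ?_ hm0
      rw [le_div_iff₀ (two_pos : (0 : K) < 2)]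
      linarith
    rw [h1] at hbound
    linarith
  exact fun i => (hle i).trans hm2

/-- **Injectivity**: on a box (a set containing, with two points, the closed box they span) on
which the Jacobian of the definable map `F` is within `η` of the identity, `2 n η ≤ 1`, the map
`F` is injective. [folklore] -/
theorem _root_.FirstOrder.Language.IsDefinablyComplete.injOn_of_jacobian_near_one
    (hDC : L.IsDefinablyComplete K)
    (hlt : (univ : Set K).Definable L {v : Fin 2 → K | v 0 < v 1})
    (hadd : (univ : Set K).Definable L {v : Fin 3 → K | v 2 = v 0 + v 1})
    (hmul : (univ : Set K).Definable L {v : Fin 3 → K | v 2 = v 0 * v 1})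
    {F : (Fin n → K) → Fin n → K} (hF : ∀ i, (univ : Set K).DefinableFun L fun x => F x i)
    {J : (Fin n → K) → Fin n → Fin n → K} {η : K} (hη : 2 * n * η ≤ 1) {B : Set (Fin n → K)}
    (hB : ∀ x ∈ B, ∀ y ∈ B, ∀ w : Fin n → K,
      (∀ j, min (x j) (y j) ≤ w j ∧ w j ≤ max (x j) (y j)) → w ∈ B)
    (hder : ∀ w ∈ B, ∀ i j, HasPartialDerivAt (fun z => F z i) j (J w i j) w)
    (hJ : ∀ w ∈ B, ∀ i j, |J w i j - if i = j then 1 else 0| ≤ η) : InjOn F B := by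
  intro x hx y hy hxy
  have h := hDC.abs_sub_le_two_mul_of_jacobian_near_one hlt hadd hmul hF hη (x := x) (y := y)
    (fun w hw i j => hder w (hB x hx y hy w hw) i j) (fun w hw i j => hJ w (hB x hx y hy w hw) i j)
    (μ := 0) (fun k => by rw [hxy, sub_self, abs_zero])
  funext i
  have hi := h i
  rw [mul_zero] at hi
  exact (eq_of_abs_sub_nonpos hi).symm

/-! ### The open mapping part -/

omit [IsStrictOrderedRing K] [L.Structure K] in
/-- Closed boxes `{x | ∀ i, aᵢ - r ≤ xᵢ ≤ aᵢ + r}` are closed. [folklore] -/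
theorem isClosed_box_center (a : Fin n → K) (r : K) :
    IsClosed {x : Fin n → K | ∀ i, a i - r ≤ x i ∧ x i ≤ a i + r} := by
  have h : {x : Fin n → K | ∀ i, a i - r ≤ x i ∧ x i ≤ a i + r} =
      ⋂ i, (fun x => x i) ⁻¹' Icc (a i - r) (a i + r) := by
    ext x; simp
  rw [h]
  exact isClosed_iInter fun i => isClosed_Icc.preimage (continuous_apply i)

omit [Field K] [IsStrictOrderedRing K] [TopologicalSpace K] [OrderTopology K] in
/-- Closed boxes `{x | ∀ i, lᵢ ≤ xᵢ ≤ uᵢ}` are definable (with `<` definable). [folklore] -/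
theorem definable_box_bounds (hlt : (univ : Set K).Definable L {v : Fin 2 → K | v 0 < v 1})
    (l u : Fin n → K) :
    (univ : Set K).Definable L {x : Fin n → K | ∀ i, l i ≤ x i ∧ x i ≤ u i} := by
  have h := definable_iInter_of_finite (L := L) (A := (univ : Set K)) fun i : Fin n =>
    (definable_setOf_le_params hlt (definableFun_const_params _ (mem_univ (l i)))
      (definableFun_proj_params (α := Fin n) i)).inter
    (definable_setOf_le_params hlt (definableFun_proj_params (α := Fin n) i)
      (definableFun_const_params _ (mem_univ (u i))))
  refine (congrArg _ ?_).mpr h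
  ext x
  simp only [mem_setOf_eq, mem_iInter, mem_inter_iff]

omit [TopologicalSpace K] [OrderTopology K] [L.Structure K] in
/-- `Σₖ uₖ² ≤ (Σₖ |uₖ|)²`. [folklore] -/
theorem sum_mul_self_le_sq_sum_abs (u : Fin n → K) :
    ∑ k, u k * u k ≤ (∑ k, |u k|) * ∑ k, |u k| := by
  have hS : ∀ k, |u k| ≤ ∑ j, |u j| := fun k =>
    Finset.single_le_sum (f := fun j => |u j|) (fun j _ => abs_nonneg (u j)) (Finset.mem_univ k)
  calc ∑ k, u k * u k = ∑ k, |u k| * |u k| := Finset.sum_congr rfl fun k _ =>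
        (abs_mul_abs_self (u k)).symm
    _ ≤ ∑ k, |u k| * ∑ j, |u j| :=
        Finset.sum_le_sum fun k _ => mul_le_mul_of_nonneg_left (hS k) (abs_nonneg _)
    _ = (∑ k, |u k|) * ∑ k, |u k| := by rw [Finset.sum_mul]

/-- The minimisation argument, step 1: a point `x` of the closed box `B` of radius `r` around
`a` at which the potential `Σₖ (F x k - yₖ)²` does not exceed its value at `a` is interior,
provided `Σᵢ |yᵢ - F a i| < r / 4` and the Jacobian is within `η` of the identity on `B`
(expansion bound: on the boundary some `|F x k - F a k| ≥ r / 2`, so the potential exceeds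
`(r/4)²`, its value at `a` being `< (r/4)²`). [folklore] -/
theorem _root_.FirstOrder.Language.IsDefinablyComplete.abs_sub_lt_of_potential_le
    (hDC : L.IsDefinablyComplete K)
    (hlt : (univ : Set K).Definable L {v : Fin 2 → K | v 0 < v 1})
    (hadd : (univ : Set K).Definable L {v : Fin 3 → K | v 2 = v 0 + v 1})
    (hmul : (univ : Set K).Definable L {v : Fin 3 → K | v 2 = v 0 * v 1})
    {F : (Fin n → K) → Fin n → K} (hF : ∀ i, (univ : Set K).DefinableFun L fun x => F x i)
    {J : (Fin n → K) → Fin n → Fin n → K} {η : K} (hη : 2 * n * η ≤ 1)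
    {a : Fin n → K} {r : K} (hr : 0 < r)
    (hder : ∀ x : Fin n → K, (∀ j, a j - r ≤ x j ∧ x j ≤ a j + r) →
      ∀ i j, HasPartialDerivAt (fun z => F z i) j (J x i j) x)
    (hJ : ∀ x : Fin n → K, (∀ j, a j - r ≤ x j ∧ x j ≤ a j + r) →
      ∀ i j, |J x i j - if i = j then 1 else 0| ≤ η)
    {y : Fin n → K} (hy : ∑ i, |y i - F a i| < r / 4)
    {x : Fin n → K} (hx : ∀ j, a j - r ≤ x j ∧ x j ≤ a j + r)
    (hφ : ∑ k, (F x k - y k) * (F x k - y k) ≤ ∑ k, (F a k - y k) * (F a k - y k)) :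
    ∀ j, |x j - a j| < r := by
  classical
  by_contra hnot
  push Not at hnot
  obtain ⟨j₀, hj₀⟩ := hnot
  haveI : Nonempty (Fin n) := ⟨j₀⟩
  have hj₀' : |x j₀ - a j₀| = r :=
    le_antisymm (abs_le.2 ⟨by linarith [(hx j₀).1], by linarith [(hx j₀).2]⟩) hj₀
  have hr4 : 0 < r / 4 := by linarith
  -- `Σ |y i - F a i| =: S < r / 4`, and the potential at `a` is `≤ S² < (r/4)²`
  set S : K := ∑ i, |y i - F a i| with hS
  have hS0 : 0 ≤ S := Finset.sum_nonneg fun i _ => abs_nonneg _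
  have hφa : ∑ k, (F a k - y k) * (F a k - y k) < r / 4 * (r / 4) := by
    have h1 := sum_mul_self_le_sq_sum_abs (fun k => F a k - y k)
    have h2 : ∑ k, |F a k - y k| = S := by
      rw [hS]; exact Finset.sum_congr rfl fun k _ => abs_sub_comm _ _
    simp only [h2] at h1
    exact h1.trans_lt (mul_self_lt_mul_self hS0 hy)
  -- `μ := maxₖ |F x k - F a k| ≥ r / 2`
  obtain ⟨k₀, -, hk₀⟩ :=
    Finset.exists_max_image Finset.univ (fun k => |F x k - F a k|) Finset.univ_nonempty
  have hsubB : ∀ w : Fin n → K, (∀ j, min (a j) (x j) ≤ w j ∧ w j ≤ max (a j) (x j)) →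
      ∀ j, a j - r ≤ w j ∧ w j ≤ a j + r := by
    intro w hw j
    have h1 := (hw j).1
    have h2 := (hw j).2
    have h3 := (hx j).1
    have h4 := (hx j).2
    constructor
    · exact le_trans (le_min (by linarith) h3) h1
    · exact le_trans h2 (max_le (by linarith) h4)
  have hexp := hDC.abs_sub_le_two_mul_of_jacobian_near_one hlt hadd hmul hF hη (x := a)
    (y := x) (fun w hw i j => hder w (hsubB w hw) i j) (fun w hw i j => hJ w (hsubB w hw) i j)
    (μ := |F x k₀ - F a k₀|) (fun k => hk₀ k (Finset.mem_univ k))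
  have hμ : r / 2 ≤ |F x k₀ - F a k₀| := by
    have := hexp j₀
    rw [hj₀'] at this
    linarith
  -- `|F x k₀ - y k₀| > r / 4`
  have hya : |F a k₀ - y k₀| < r / 4 := by
    have h : |F a k₀ - y k₀| ≤ S := by
      rw [abs_sub_comm, hS]
      exact Finset.single_le_sum (f := fun i => |y i - F a i|) (fun i _ => abs_nonneg _)
        (Finset.mem_univ k₀)
    exact h.trans_lt hy
  have hbig : r / 4 < |F x k₀ - y k₀| := by
    have h1 : |F x k₀ - F a k₀| ≤ |F x k₀ - y k₀| + |F a k₀ - y k₀| := by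
      calc |F x k₀ - F a k₀| = |(F x k₀ - y k₀) - (F a k₀ - y k₀)| := by ring_nf
        _ ≤ |F x k₀ - y k₀| + |F a k₀ - y k₀| := abs_sub _ _
    linarith
  have hφx : r / 4 * (r / 4) < ∑ k, (F x k - y k) * (F x k - y k) := by
    have h1 : r / 4 * (r / 4) < (F x k₀ - y k₀) * (F x k₀ - y k₀) := by
      calc r / 4 * (r / 4) < |F x k₀ - y k₀| * |F x k₀ - y k₀| :=
            mul_lt_mul'' hbig hbig hr4.le hr4.le
        _ = (F x k₀ - y k₀) * (F x k₀ - y k₀) := abs_mul_abs_self _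
    refine h1.trans_le ?_
    exact Finset.single_le_sum (f := fun k => (F x k - y k) * (F x k - y k))
      (fun k _ => mul_self_nonneg _) (Finset.mem_univ k₀)
  linarith

/-- The minimisation argument, step 2: at an interior point `x` of the box `B` minimising the
potential `Σₖ (F x k - yₖ)²` over `B`, the partial derivatives `2 Σₖ (F x k - yₖ) J x k j`
vanish (Fermat, `DefinablyCompleteCalculus.lean`), so `F x = y` by diagonal dominance.
[folklore] -/
theorem eq_of_isMinOn_potential
    {F : (Fin n → K) → Fin n → K} {J : (Fin n → K) → Fin n → Fin n → K} {η : K}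
    (hη : 2 * n * η ≤ 1) {a : Fin n → K} {r : K}
    (hder : ∀ x : Fin n → K, (∀ j, a j - r ≤ x j ∧ x j ≤ a j + r) →
      ∀ i j, HasPartialDerivAt (fun z => F z i) j (J x i j) x)
    (hJ : ∀ x : Fin n → K, (∀ j, a j - r ≤ x j ∧ x j ≤ a j + r) →
      ∀ i j, |J x i j - if i = j then 1 else 0| ≤ η)
    {y x : Fin n → K} (hx : ∀ j, |x j - a j| < r)
    (hmin : ∀ x' : Fin n → K, (∀ j, a j - r ≤ x' j ∧ x' j ≤ a j + r) →
      ∑ k, (F x k - y k) * (F x k - y k) ≤ ∑ k, (F x' k - y k) * (F x' k - y k)) :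
    F x = y := by
  classical
  have hxB : ∀ j, a j - r ≤ x j ∧ x j ≤ a j + r := fun j =>
    ⟨by linarith [(abs_lt.1 (hx j)).1], by linarith [(abs_lt.1 (hx j)).2]⟩
  have hxI : ∀ j, x j ∈ Ioo (a j - r) (a j + r) := fun j =>
    ⟨by linarith [(abs_lt.1 (hx j)).1], by linarith [(abs_lt.1 (hx j)).2]⟩
  have hcrit : ∀ j, ∑ k, (F x k - y k) * J x k j = 0 := by
    intro j
    -- the slice of the potential along the `j`-th coordinate and its derivative at `x j`
    have hslice : HasFieldDerivAt
        (fun t => ∑ k, (F (update x j t) k - y k) * (F (update x j t) k - y k))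
        (∑ k, ((J x k j) * (F x k - y k) + (F x k - y k) * (J x k j))) (x j) := by
      refine HasFieldDerivAt.sum (Finset.univ : Finset (Fin n))
        (f := fun k t => (F (update x j t) k - y k) * (F (update x j t) k - y k))
        (f' := fun k => (J x k j) * (F x k - y k) + (F x k - y k) * (J x k j))
        (x := x j) fun k _ => ?_
      have hk : HasFieldDerivAt (fun t => F (update x j t) k - y k) (J x k j) (x j) := by
        have h1 := hder x hxB k j
        rw [hasPartialDerivAt_iff] at h1
        have h2 := h1.sub (hasFieldDerivAt_const (y k) (x j))
        simpa using h2
      have hmulk := hk.mul hk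
      simpa only [update_eq_self] using hmulk
    have hmin' : IsMinOn (fun t => ∑ k, (F (update x j t) k - y k) * (F (update x j t) k - y k))
        (Ioo (a j - r) (a j + r)) (x j) := by
      intro t ht
      have htB : ∀ i, a i - r ≤ update x j t i ∧ update x j t i ≤ a i + r := by
        intro i
        by_cases hi : i = j
        · subst hi; simpa using And.intro ht.1.le ht.2.le
        · simpa [update_of_ne hi] using hxB i
      have h := hmin _ htB
      simpa [update_eq_self] using h
    have hzero := hslice.eq_zero_of_isMinOn (hxI j) hmin'
    have hsum : ∑ k, ((J x k j) * (F x k - y k) + (F x k - y k) * (J x k j)) =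
        2 * ∑ k, (F x k - y k) * J x k j := by
      rw [Finset.mul_sum]
      exact Finset.sum_congr rfl fun k _ => by ring
    rw [hsum] at hzero
    exact (mul_eq_zero.1 hzero).resolve_left two_ne_zero
  have hv := eq_zero_of_forall_sum_mul_eq_zero (A := J x) hη (hJ x hxB)
    (v := fun k => F x k - y k) hcrit
  funext k
  have := congr_fun hv k
  simpa [sub_eq_zero] using this

/-- **The open mapping part of the inverse function theorem** (Jacobian near the identity): let
the definable map `F` be continuous (componentwise) on the closed box
`B = {x | ∀ i, |xᵢ - aᵢ| ≤ r}`, `r > 0`, with partial derivatives `J x i j` at the points of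
`B` satisfying `|J x i j - δᵢⱼ| ≤ η`, `2 n η ≤ 1`.  Then every `y` with
`Σᵢ |yᵢ - F a i| < r / 4` is attained: `y = F x` for some `x` with `|xᵢ - aᵢ| < r` for all `i`.
(Minimise `Σₖ (F x k - yₖ)²` over `B` by the extreme value theorem of
`DefinablyCompactBoxes.lean`; the minimum point is interior by
`abs_sub_lt_of_potential_le` and then `F x = y` by `eq_of_isMinOn_potential`.) [folklore] -/
theorem _root_.FirstOrder.Language.IsDefinablyComplete.exists_eq_of_jacobian_near_one
    (hDC : L.IsDefinablyComplete K)
    (hlt : (univ : Set K).Definable L {v : Fin 2 → K | v 0 < v 1})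
    (hadd : (univ : Set K).Definable L {v : Fin 3 → K | v 2 = v 0 + v 1})
    (hmul : (univ : Set K).Definable L {v : Fin 3 → K | v 2 = v 0 * v 1})
    {F : (Fin n → K) → Fin n → K} (hF : ∀ i, (univ : Set K).DefinableFun L fun x => F x i)
    {J : (Fin n → K) → Fin n → Fin n → K} {η : K} (hη : 2 * n * η ≤ 1)
    {a : Fin n → K} {r : K} (hr : 0 < r)
    (hcont : ∀ i, ContinuousOn (fun x => F x i) {x | ∀ j, a j - r ≤ x j ∧ x j ≤ a j + r})
    (hder : ∀ x : Fin n → K, (∀ j, a j - r ≤ x j ∧ x j ≤ a j + r) →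
      ∀ i j, HasPartialDerivAt (fun z => F z i) j (J x i j) x)
    (hJ : ∀ x : Fin n → K, (∀ j, a j - r ≤ x j ∧ x j ≤ a j + r) →
      ∀ i j, |J x i j - if i = j then 1 else 0| ≤ η)
    {y : Fin n → K} (hy : ∑ i, |y i - F a i| < r / 4) :
    ∃ x : Fin n → K, (∀ j, |x j - a j| < r) ∧ F x = y := by
  classical
  set B : Set (Fin n → K) := {x | ∀ j, a j - r ≤ x j ∧ x j ≤ a j + r} with hB
  have haB : a ∈ B := fun j => ⟨by linarith, by linarith⟩
  -- the potential and its minimum on `B`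
  set φ : (Fin n → K) → K := fun x => ∑ k, (F x k - y k) * (F x k - y k) with hφ
  have hφdef : (univ : Set K).DefinableFun L φ := by
    refine definableFun_sum hadd Finset.univ fun k _ => ?_
    have hk : (univ : Set K).DefinableFun L fun x => F x k - y k :=
      definableFun_apply₂_params (definable_sub_of_add hadd) (hF k)
        (definableFun_const_params _ (mem_univ (y k)))
    exact definableFun_apply₂_params hmul hk hk
  have hφcont : ContinuousOn φ B := by
    refine continuousOn_finsetSum _ fun k _ => ?_
    exact ((hcont k).sub continuousOn_const).mul ((hcont k).sub continuousOn_const)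
  have hBdef : (univ : Set K).Definable L B := definable_box_bounds hlt _ _
  have hBcl : IsClosed B := isClosed_box_center a r
  set R : K := ∑ j, |a j| + r with hR
  have hBsub : ∀ x ∈ B, ∀ i, -R ≤ x i ∧ x i ≤ R := by
    intro x hx i
    have h1 := (hx i).1
    have h2 := (hx i).2
    have h3 : |a i| ≤ ∑ j, |a j| :=
      Finset.single_le_sum (f := fun j => |a j|) (fun j _ => abs_nonneg (a j))
        (Finset.mem_univ i)
    have h4 := le_abs_self (a i)
    have h5 := neg_abs_le (a i)
    rw [hR]
    constructor <;> linarith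
  obtain ⟨x₀, hx₀B, hmin⟩ := hDC.exists_forall_ge_of_continuousOn_pi hlt hadd hBdef hBcl
    ⟨a, haB⟩ hBsub hφdef hφcont
  have hinner : ∀ j, |x₀ j - a j| < r :=
    hDC.abs_sub_lt_of_potential_le hlt hadd hmul hF hη hr hder hJ hy hx₀B (hmin a haB)
  exact ⟨x₀, hinner, eq_of_isMinOn_potential hη hder hJ hinner fun x' hx' => hmin x' hx'⟩

end Literature.ModelTheory.ExponentialFields
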